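import Mathlib.Analysis.Matrix.Hermitian
import Mathlib.LinearAlgebra.Matrix.PosDef
import Mathlib.Order.Filter.AtTopBot.Basic
import Literature.Analysis.InnerProduct.CholeskyResidualEigenvalueBounds
import HarnessLib

/-!
# Ventures/CertifiedQuantumChemistry — Rows/GenericLiftAnalyticStep.lean: the ANALYTIC LAST STEP of
# the generic linear lift (LEMMA GL): a margin beats a polynomial perturbation for large `U`, the
# scaled congruence transfers it to the block, rows / boxes along the family, and the `limsup` step

HONEST FRAMING (verbatim): certified bounds for a stated model Hamiltonian in a stated basis; not a
claim about the real molecule beyond that model. The lifted families this file speaks about are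
auxiliary feasible points of finite-`U` RELAXATIONS and of their strong-coupling limit programmes
`X_∞`; nothing here is a state, a row, a claim node or a value of record.

Seat rdm-B (gen 30), zero compute; theorems only (no `def`). LEMMA GL (HOME/INBOX «WORDS+CERT Q1(6)
(rdm-B)», gen 25; checkers `code/qchem_rdm_b/check_genlift.py` / `check_lift2.py`; used at L = 6, 8,
10, 12 for the EXISTENCE leg of every RULE ENC-L) has an ALGEBRAIC part — the exact identities
(A)–(F) its certificates carry and its checkers re-verify — and an ANALYTIC conclusion stated in
words: "with `T(ε) = [V_j | W_j/ε]`, `T(ε)ᵀ B_j(y(ε)) T(ε) = L_j(z) + ε R₁ + ε² R₂` is POLYNOMIAL,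
`L_j(z) ⪰ λμ_j·1` on the forced complement, so `B_j(y(ε)) ⪰ 0` for `ε ≤ min(1, λμ_j/(‖R₁‖ + ‖R₂‖))`;
rows hold identically, boxes for small `ε`; `U₀` = the largest of finitely many thresholds; hence
`limsup_U U·OPT_X(L;U) ≤ v(X_∞)`". This file TYPES that analytic conclusion from abstract hypotheses
of exactly those shapes (the identities themselves are the certificates' business):

* §1 `GenericLift.posSemidef_add_of_margin` — `L − μ·1 ⪰ 0`, `P` Hermitian with an entrywise
  dominating real matrix of row and column sums `≤ r`, `r ≤ μ` ⇒ `L + P ⪰ 0` (the margin beats the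
  perturbation; the norm bound is `Literature/Analysis/InnerProduct/CholeskyResidualEigenvalueBounds`'
  `norm_star_dotProduct_mulVec_le_of_norm_le_rowSum_colSum`, i.e. `‖P‖₂ ≤ √(‖N‖₁‖N‖_∞) ≤ r`; the
  words' Frobenius norm is one admissible `r`).
* §2 `GenericLift.posSemidef_family` — the POLYNOMIAL FAMILY `L + ε R₁ + ε² R₂ ⪰ 0` whenever
  `0 ≤ ε` and `ε r₁ + ε² r₂ ≤ μ`; `posSemidef_family_of_le` — the "for all `U ≥ U₀`" form with
  `ε = 1/U`, `U ≥ 1` and `U ≥ (r₁ + r₂)/μ` (`μ > 0`).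
* §3 `GenericLift.posSemidef_of_conj_isUnit` / `posSemidef_of_scaled_congruence` — an INVERTIBLE
  congruence transfers positivity back: `T` a unit and `Tᴴ B T = L + ε R₁ + ε² R₂` as in §2 ⇒ `B ⪰ 0`
  (`T(ε) = [V | W/ε]` is invertible for `ε ≠ 0` because `V ∪ W` is a basis — hypothesis (C)).
* §4 `GenericLift.rows_family` / `abs_family_le` / `abs_mix_le_sub` — equality rows hold along
  `z + ε y₁ + ε² y₂` when `z` satisfies them and `y₁, y₂` the homogeneous rows; boxes `|·| ≤ ρ` hold
  for `ε ≤ δ/K` when `|z| ≤ ρ − δ` and `|y₁| + |y₂| ≤ K`; and the mixture with the anchor supplies the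
  margin: `|ŷ| ≤ ρ`, `|y_int| ≤ ρ − δ` ⇒ `|(1−λ)ŷ + λ y_int| ≤ ρ − λδ` (the words' `1 − λ/2`).
* §5 `GenericLift.eventually_le_sInf_add` / `eventually_lt_of_lt` — THE `limsup` STEP, pure
  order/real analysis: if for every feasible objective value `t ∈ S` and every `λ ∈ (0, 1]` the lift
  gives `U·OPT(U) ≤ (1−λ) t + λ t_int + h₂/U` for all large `U`, then for every `η > 0`,
  `U·OPT(U) ≤ inf S + η` for all large `U` (density: `t` near `inf S`, `λ` small, `U` large) — i.e.
  `limsup_U U·OPT(U) ≤ v(X_∞) = inf S`, written as "eventually below every `a > inf S`".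

Scalars: §1–§3 over any `RCLike` field (`ℝ` for the cell), Mathlib's `ComplexOrder` convention; §4–§5
over `ℝ`. Everything is PROVED (0 sorry). References (docstring-only): eigenvalue perturbation by a
norm-bounded Hermitian matrix (Weyl), e.g. R. A. Horn, C. R. Johnson, *Matrix Analysis* (2013) §4.3,
§5.6; the rest is elementary.
-/

namespace Summit.Ventures.CertifiedQuantumChemistry

open Matrix Finset
open scoped ComplexOrder

namespace GenericLift

/-! ### §1 A margin beats a dominated Hermitian perturbation -/

section PSD

variable {𝕜 : Type*} [RCLike 𝕜] {m : Type*} [Fintype m] [DecidableEq m]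

omit [Fintype m] in
/-- A real multiple of the identity is Hermitian (plumbing). [folklore] -/
theorem isHermitian_real_smul_one (μ : ℝ) : ((μ : 𝕜) • (1 : Matrix m m 𝕜)).IsHermitian := by
  rw [IsHermitian, conjTranspose_smul, conjTranspose_one, RCLike.star_def, RCLike.conj_ofReal]

omit [Fintype m] [DecidableEq m] in
/-- A real multiple of a Hermitian matrix is Hermitian (plumbing). [folklore] -/
theorem isHermitian_real_smul {R : Matrix m m 𝕜} (hR : R.IsHermitian) (ε : ℝ) :
    ((ε : 𝕜) • R).IsHermitian := by
  rw [IsHermitian, conjTranspose_smul, hR.eq, RCLike.star_def, RCLike.conj_ofReal]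

/-- **MARGIN BEATS PERTURBATION.** If `L − μ·1 ⪰ 0` and `P` is Hermitian with `‖P i j‖ ≤ N i j` for
a real matrix `N` whose row sums and column sums are `≤ r`, and `r ≤ μ`, then `L + P ⪰ 0`
(`⟨v, (L+P) v⟩ ≥ μ‖v‖² − r‖v‖² ≥ 0`). [folklore; Weyl's inequality with `‖P‖₂ ≤ √(‖N‖₁‖N‖_∞)`] -/
theorem posSemidef_add_of_margin {L P : Matrix m m 𝕜} {μ r : ℝ}
    (hL : (L - (μ : 𝕜) • (1 : Matrix m m 𝕜)).PosSemidef) (hP : P.IsHermitian)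
    (N : Matrix m m ℝ) (hdom : ∀ i j, ‖P i j‖ ≤ N i j)
    (hrow : ∀ i, ∑ j, N i j ≤ r) (hcol : ∀ j, ∑ i, N i j ≤ r) (hr : r ≤ μ) :
    (L + P).PosSemidef := by
  have hLh : L.IsHermitian := by
    have h := hL.1.add (isHermitian_real_smul_one (𝕜 := 𝕜) (m := m) μ)
    rwa [sub_add_cancel] at h
  have hherm : (L + P).IsHermitian := hLh.add hP
  refine PosSemidef.of_dotProduct_mulVec_nonneg hherm fun v => ?_
  rw [RCLike.nonneg_iff]
  refine ⟨?_, hherm.im_star_dotProduct_mulVec_self v⟩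
  have hsplit : star v ⬝ᵥ ((L + P) *ᵥ v) =
      star v ⬝ᵥ ((L - (μ : 𝕜) • (1 : Matrix m m 𝕜)) *ᵥ v) + (μ : 𝕜) * (star v ⬝ᵥ v)
        + star v ⬝ᵥ (P *ᵥ v) := by
    rw [add_mulVec, dotProduct_add, sub_mulVec, dotProduct_sub, smul_mulVec, one_mulVec,
      dotProduct_smul, smul_eq_mul]
    ring
  have h1 : 0 ≤ RCLike.re (star v ⬝ᵥ ((L - (μ : 𝕜) • (1 : Matrix m m 𝕜)) *ᵥ v)) :=
    (RCLike.nonneg_iff.mp (hL.dotProduct_mulVec_nonneg v)).1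
  have h2 := Literature.Analysis.InnerProduct.norm_star_dotProduct_mulVec_le_of_norm_le_rowSum_colSum
    P N hdom hrow hcol v
  have h3 : -(r * ∑ i, ‖v i‖ ^ 2) ≤ RCLike.re (star v ⬝ᵥ (P *ᵥ v)) :=
    (abs_le.1 ((RCLike.abs_re_le_norm _).trans h2)).1
  have hsq : (0 : ℝ) ≤ ∑ i, ‖v i‖ ^ 2 := Finset.sum_nonneg fun i _ => by positivity
  have hrs := mul_le_mul_of_nonneg_right hr hsq
  rw [hsplit, map_add, map_add, Literature.Analysis.InnerProduct.star_dotProduct_self_eq_ofReal_sum,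
    ← RCLike.ofReal_mul, RCLike.ofReal_re]
  linarith

/-! ### §2 The polynomial family `L + ε R₁ + ε² R₂` -/

/-- **POLYNOMIAL FAMILY.** `L − μ·1 ⪰ 0`, `R₁, R₂` Hermitian with dominating real matrices `N₁, N₂`
of row / column sums `≤ r₁, r₂`; then for every `ε ≥ 0` with `ε r₁ + ε² r₂ ≤ μ` the matrix
`L + ε R₁ + ε² R₂` is positive semidefinite. [folklore] -/
theorem posSemidef_family {L R₁ R₂ : Matrix m m 𝕜} {μ r₁ r₂ : ℝ}
    (hL : (L - (μ : 𝕜) • (1 : Matrix m m 𝕜)).PosSemidef)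
    (hR₁ : R₁.IsHermitian) (hR₂ : R₂.IsHermitian) (N₁ N₂ : Matrix m m ℝ)
    (hdom₁ : ∀ i j, ‖R₁ i j‖ ≤ N₁ i j) (hdom₂ : ∀ i j, ‖R₂ i j‖ ≤ N₂ i j)
    (hrow₁ : ∀ i, ∑ j, N₁ i j ≤ r₁) (hcol₁ : ∀ j, ∑ i, N₁ i j ≤ r₁)
    (hrow₂ : ∀ i, ∑ j, N₂ i j ≤ r₂) (hcol₂ : ∀ j, ∑ i, N₂ i j ≤ r₂)
    {ε : ℝ} (hε0 : 0 ≤ ε) (hε : ε * r₁ + ε ^ 2 * r₂ ≤ μ) :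
    (L + (ε : 𝕜) • R₁ + ((ε ^ 2 : ℝ) : 𝕜) • R₂).PosSemidef := by
  rw [add_assoc]
  refine posSemidef_add_of_margin hL ((isHermitian_real_smul hR₁ ε).add (isHermitian_real_smul hR₂ _))
    (ε • N₁ + (ε ^ 2) • N₂) (fun i j => ?_) (fun i => ?_) (fun j => ?_) hε
  · rw [Matrix.add_apply, Matrix.smul_apply, Matrix.smul_apply, Matrix.add_apply, Matrix.smul_apply,
      Matrix.smul_apply, smul_eq_mul, smul_eq_mul, smul_eq_mul, smul_eq_mul]
    calc ‖(ε : 𝕜) * R₁ i j + ((ε ^ 2 : ℝ) : 𝕜) * R₂ i j‖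
        ≤ ‖(ε : 𝕜) * R₁ i j‖ + ‖((ε ^ 2 : ℝ) : 𝕜) * R₂ i j‖ := norm_add_le _ _
      _ = ε * ‖R₁ i j‖ + ε ^ 2 * ‖R₂ i j‖ := by
          rw [norm_mul, norm_mul, RCLike.norm_ofReal, RCLike.norm_ofReal, abs_of_nonneg hε0,
            abs_of_nonneg (sq_nonneg ε)]
      _ ≤ ε * N₁ i j + ε ^ 2 * N₂ i j :=
          add_le_add (mul_le_mul_of_nonneg_left (hdom₁ i j) hε0)
            (mul_le_mul_of_nonneg_left (hdom₂ i j) (sq_nonneg ε))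
  · have e : ∑ j, (ε • N₁ + ε ^ 2 • N₂) i j = ε * ∑ j, N₁ i j + ε ^ 2 * ∑ j, N₂ i j := by
      simp only [Matrix.add_apply, Matrix.smul_apply, smul_eq_mul]
      rw [Finset.sum_add_distrib, Finset.mul_sum, Finset.mul_sum]
    rw [e]
    exact add_le_add (mul_le_mul_of_nonneg_left (hrow₁ i) hε0)
      (mul_le_mul_of_nonneg_left (hrow₂ i) (sq_nonneg ε))
  · have e : ∑ i, (ε • N₁ + ε ^ 2 • N₂) i j = ε * ∑ i, N₁ i j + ε ^ 2 * ∑ i, N₂ i j := by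
      simp only [Matrix.add_apply, Matrix.smul_apply, smul_eq_mul]
      rw [Finset.sum_add_distrib, Finset.mul_sum, Finset.mul_sum]
    rw [e]
    exact add_le_add (mul_le_mul_of_nonneg_left (hcol₁ j) hε0)
      (mul_le_mul_of_nonneg_left (hcol₂ j) (sq_nonneg ε))

/-- **"FOR ALL `U ≥ U₀`".** In the setting of `posSemidef_family` with `μ > 0` and `r₂ ≥ 0`, the
family at `ε = 1/U` is positive semidefinite for every `U ≥ max(1, (r₁ + r₂)/μ)` — the words'
`ε ≤ min(1, λμ_j/(‖R₁‖ + ‖R₂‖))`, one finite threshold per block. [folklore] -/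
theorem posSemidef_family_of_le {L R₁ R₂ : Matrix m m 𝕜} {μ r₁ r₂ : ℝ}
    (hL : (L - (μ : 𝕜) • (1 : Matrix m m 𝕜)).PosSemidef)
    (hR₁ : R₁.IsHermitian) (hR₂ : R₂.IsHermitian) (N₁ N₂ : Matrix m m ℝ)
    (hdom₁ : ∀ i j, ‖R₁ i j‖ ≤ N₁ i j) (hdom₂ : ∀ i j, ‖R₂ i j‖ ≤ N₂ i j)
    (hrow₁ : ∀ i, ∑ j, N₁ i j ≤ r₁) (hcol₁ : ∀ j, ∑ i, N₁ i j ≤ r₁)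
    (hrow₂ : ∀ i, ∑ j, N₂ i j ≤ r₂) (hcol₂ : ∀ j, ∑ i, N₂ i j ≤ r₂)
    (hμ : 0 < μ) (hr₂ : 0 ≤ r₂) {U : ℝ} (hU1 : 1 ≤ U) (hU : (r₁ + r₂) / μ ≤ U) :
    (L + ((1 / U : ℝ) : 𝕜) • R₁ + (((1 / U) ^ 2 : ℝ) : 𝕜) • R₂).PosSemidef := by
  have hU0 : 0 < U := lt_of_lt_of_le one_pos hU1
  refine posSemidef_family hL hR₁ hR₂ N₁ N₂ hdom₁ hdom₂ hrow₁ hcol₁ hrow₂ hcol₂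
    (div_nonneg one_pos.le hU0.le) ?_
  have hε1 : 1 / U ≤ 1 := (div_le_one hU0).mpr hU1
  have hsum : r₁ + r₂ ≤ U * μ := (div_le_iff₀ hμ).mp hU
  have hεsum : 1 / U * (r₁ + r₂) ≤ μ := by
    rw [one_div_mul_eq_div, div_le_iff₀ hU0]
    linarith
  have hsq : (1 / U) ^ 2 * r₂ ≤ 1 / U * r₂ := by
    have : (1 / U) ^ 2 ≤ 1 / U := by
      rw [sq]
      exact mul_le_of_le_one_left (div_nonneg one_pos.le hU0.le) hε1
    exact mul_le_mul_of_nonneg_right this hr₂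
  nlinarith

/-! ### §3 The scaled congruence transfers positivity back to the block -/

/-- If `T` is invertible then `Tᴴ B T ⪰ 0` implies `B ⪰ 0` (Mathlib's congruence criterion, in the
cell's spelling). [folklore] -/
theorem posSemidef_of_conj_isUnit {B T : Matrix m m 𝕜} (hT : IsUnit T) (h : (Tᴴ * B * T).PosSemidef) :
    B.PosSemidef := by
  rw [← star_eq_conjTranspose] at h
  exact hT.posSemidef_star_left_conjugate_iff.mp h

/-- **THE BLOCK STEP OF LEMMA GL.** If an invertible `T` (the words' `T(ε) = [V | W/ε]`, invertible
for `ε ≠ 0` since `V ∪ W` is a basis) congruences the block to the polynomial family,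
`Tᴴ B T = L + ε R₁ + ε² R₂` with `L − μ·1 ⪰ 0` (the mixture's margin `λμ_j` on the forced
complement) and dominated Hermitian `R₁, R₂`, then `B ⪰ 0` as soon as `0 ≤ ε` and
`ε r₁ + ε² r₂ ≤ μ`. [folklore] -/
theorem posSemidef_of_scaled_congruence {B T L R₁ R₂ : Matrix m m 𝕜} {μ r₁ r₂ ε : ℝ}
    (hT : IsUnit T) (hTBT : Tᴴ * B * T = L + (ε : 𝕜) • R₁ + ((ε ^ 2 : ℝ) : 𝕜) • R₂)
    (hL : (L - (μ : 𝕜) • (1 : Matrix m m 𝕜)).PosSemidef)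
    (hR₁ : R₁.IsHermitian) (hR₂ : R₂.IsHermitian) (N₁ N₂ : Matrix m m ℝ)
    (hdom₁ : ∀ i j, ‖R₁ i j‖ ≤ N₁ i j) (hdom₂ : ∀ i j, ‖R₂ i j‖ ≤ N₂ i j)
    (hrow₁ : ∀ i, ∑ j, N₁ i j ≤ r₁) (hcol₁ : ∀ j, ∑ i, N₁ i j ≤ r₁)
    (hrow₂ : ∀ i, ∑ j, N₂ i j ≤ r₂) (hcol₂ : ∀ j, ∑ i, N₂ i j ≤ r₂)
    (hε0 : 0 ≤ ε) (hε : ε * r₁ + ε ^ 2 * r₂ ≤ μ) : B.PosSemidef := by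
  refine posSemidef_of_conj_isUnit hT ?_
  rw [hTBT]
  exact posSemidef_family hL hR₁ hR₂ N₁ N₂ hdom₁ hdom₂ hrow₁ hcol₁ hrow₂ hcol₂ hε0 hε

end PSD

/-! ### §4 Rows and boxes along the family -/

section Affine

variable {V E : Type*} [Fintype V]

/-- Equality rows hold identically along `z + ε y₁ + ε² y₂` when `z` satisfies them and the corrections
satisfy the HOMOGENEOUS rows. [folklore] -/
theorem rows_family (A : E → V → ℝ) (b : E → ℝ) {z y₁ y₂ : V → ℝ}
    (hz : ∀ e, ∑ v, A e v * z v = b e) (h₁ : ∀ e, ∑ v, A e v * y₁ v = 0)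
    (h₂ : ∀ e, ∑ v, A e v * y₂ v = 0) (ε : ℝ) (e : E) :
    ∑ v, A e v * (z v + ε * y₁ v + ε ^ 2 * y₂ v) = b e := by
  have hsplit : ∑ v, A e v * (z v + ε * y₁ v + ε ^ 2 * y₂ v) =
      ∑ v, A e v * z v + ε * ∑ v, A e v * y₁ v + ε ^ 2 * ∑ v, A e v * y₂ v := by
    rw [Finset.mul_sum, Finset.mul_sum, ← Finset.sum_add_distrib, ← Finset.sum_add_distrib]
    exact Finset.sum_congr rfl fun v _ => by ring
  rw [hsplit, hz e, h₁ e, h₂ e]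
  ring

/-- Boxes along the family: `|z| ≤ ρ − δ`, `|y₁| + |y₂| ≤ K`, `0 ≤ ε ≤ 1`, `ε K ≤ δ` ⇒
`|z + ε y₁ + ε² y₂| ≤ ρ`. [folklore] -/
theorem abs_family_le {z y₁ y₂ ρ δ K ε : ℝ} (hz : |z| ≤ ρ - δ) (hK : |y₁| + |y₂| ≤ K)
    (hε0 : 0 ≤ ε) (hε1 : ε ≤ 1) (hε : ε * K ≤ δ) : |z + ε * y₁ + ε ^ 2 * y₂| ≤ ρ := by
  have h1 : |z + ε * y₁ + ε ^ 2 * y₂| ≤ |z| + ε * |y₁| + ε ^ 2 * |y₂| := by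
    calc |z + ε * y₁ + ε ^ 2 * y₂| ≤ |z + ε * y₁| + |ε ^ 2 * y₂| := abs_add_le _ _
      _ ≤ |z| + |ε * y₁| + |ε ^ 2 * y₂| := by linarith [abs_add_le z (ε * y₁)]
      _ = |z| + ε * |y₁| + ε ^ 2 * |y₂| := by
          rw [abs_mul, abs_mul, abs_of_nonneg hε0, abs_of_nonneg (sq_nonneg ε)]
  have h2 : ε ^ 2 * |y₂| ≤ ε * |y₂| := by
    have : ε ^ 2 ≤ ε := by rw [sq]; exact mul_le_of_le_one_left hε0 hε1
    exact mul_le_mul_of_nonneg_right this (abs_nonneg _)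
  have h3 : ε * (|y₁| + |y₂|) ≤ ε * K := mul_le_mul_of_nonneg_left hK hε0
  nlinarith

/-- The mixture with the anchor supplies the box margin: `|ŷ| ≤ ρ`, `|y_int| ≤ ρ − δ`, `0 ≤ λ ≤ 1`
⇒ `|(1−λ) ŷ + λ y_int| ≤ ρ − λδ` (the words' `|z_v| ≤ 1 − λ/2` with `ρ = 1`, `δ = 1/2`).
[folklore] -/
theorem abs_mix_le_sub {s t ρ δ lam : ℝ} (hs : |s| ≤ ρ) (ht : |t| ≤ ρ - δ) (hlam0 : 0 ≤ lam)
    (hlam1 : lam ≤ 1) : |(1 - lam) * s + lam * t| ≤ ρ - lam * δ := by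
  calc |(1 - lam) * s + lam * t| ≤ |(1 - lam) * s| + |lam * t| := abs_add_le _ _
    _ = (1 - lam) * |s| + lam * |t| := by
        rw [abs_mul, abs_mul, abs_of_nonneg (sub_nonneg.mpr hlam1), abs_of_nonneg hlam0]
    _ ≤ (1 - lam) * ρ + lam * (ρ - δ) :=
        add_le_add (mul_le_mul_of_nonneg_left hs (sub_nonneg.mpr hlam1))
          (mul_le_mul_of_nonneg_left ht hlam0)
    _ = ρ - lam * δ := by ring

end Affine

/-! ### §5 The `limsup` step -/

section Limsup

/-- **THE `limsup` STEP OF LEMMA GL.** Let `S` be the (nonempty, bounded-below) set of objective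
values `c·ŷ` of the limit programme's feasible points, `t_int = c·y_int` the anchor's value, `h₂` a
constant, and `g U = U·OPT(U)` the scaled finite-`U` optimum. If for every `t ∈ S` and every
`λ ∈ (0, 1]` the lifted family gives `g U ≤ (1−λ) t + λ t_int + h₂/U` for all `U ≥ U₀(t, λ)`, then for
every `η > 0` there is `U₀` with `g U ≤ inf S + η` for all `U ≥ U₀`. [folklore] -/
theorem eventually_le_sInf_add (g : ℝ → ℝ) (S : Set ℝ) (hS : S.Nonempty) {tint h₂ : ℝ}
    (H : ∀ t ∈ S, ∀ lam : ℝ, 0 < lam → lam ≤ 1 →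
      ∃ U₀ : ℝ, ∀ U ≥ U₀, g U ≤ (1 - lam) * t + lam * tint + h₂ / U)
    {η : ℝ} (hη : 0 < η) : ∃ U₀ : ℝ, ∀ U ≥ U₀, g U ≤ sInf S + η := by
  -- a feasible value within η/3 of the infimum
  obtain ⟨t, htS, ht⟩ : ∃ t ∈ S, t < sInf S + η / 3 :=
    exists_lt_of_csInf_lt hS (by linarith)
  -- a mixing parameter small enough for the anchor's lever arm
  set d : ℝ := tint - t with hd
  set lam : ℝ := min 1 (η / (3 * (|d| + 1))) with hlam
  have hden : 0 < 3 * (|d| + 1) := by positivity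
  have hlam0 : 0 < lam := lt_min one_pos (div_pos hη hden)
  have hlam1 : lam ≤ 1 := min_le_left _ _
  have hlamd : lam * d ≤ η / 3 := by
    have h1 : lam * d ≤ lam * |d| := mul_le_mul_of_nonneg_left (le_abs_self d) hlam0.le
    have h2 : lam * |d| ≤ η / (3 * (|d| + 1)) * |d| :=
      mul_le_mul_of_nonneg_right (min_le_right _ _) (abs_nonneg d)
    have h3 : η / (3 * (|d| + 1)) * |d| ≤ η / 3 := by
      rw [div_mul_eq_mul_div, div_le_iff₀ hden]
      nlinarith [abs_nonneg d]
    linarith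
  obtain ⟨U₀, hU₀⟩ := H t htS lam hlam0 hlam1
  -- `U` large enough for the `h₂/U` tail
  refine ⟨max U₀ (3 * |h₂| / η + 1), fun U hU => ?_⟩
  have hU1 : U₀ ≤ U := le_trans (le_max_left _ _) hU
  have hU2 : 3 * |h₂| / η + 1 ≤ U := le_trans (le_max_right _ _) hU
  have hUpos : 0 < U := by
    have : 0 ≤ 3 * |h₂| / η := by positivity
    linarith
  have htail : h₂ / U ≤ η / 3 := by
    have h1 : h₂ / U ≤ |h₂| / U := div_le_div_of_nonneg_right (le_abs_self h₂) hUpos.le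
    have h2 : |h₂| / U ≤ η / 3 := by
      rw [div_le_iff₀ hUpos]
      have : 3 * |h₂| ≤ η * (3 * |h₂| / η + 1) := by
        rw [mul_add, mul_div_cancel₀ _ hη.ne']
        linarith
      nlinarith
    linarith
  have hmain := hU₀ U hU1
  have e : (1 - lam) * t + lam * tint = t + lam * d := by rw [hd]; ring
  rw [e] at hmain
  linarith

/-- `limsup_U g(U) ≤ inf S`, spelled without boundedness side conditions: `g` is EVENTUALLY below
every `a > inf S`. [folklore] -/
theorem eventually_lt_of_lt (g : ℝ → ℝ) (S : Set ℝ) (hS : S.Nonempty) {tint h₂ : ℝ}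
    (H : ∀ t ∈ S, ∀ lam : ℝ, 0 < lam → lam ≤ 1 →
      ∃ U₀ : ℝ, ∀ U ≥ U₀, g U ≤ (1 - lam) * t + lam * tint + h₂ / U)
    {a : ℝ} (ha : sInf S < a) : ∀ᶠ U in Filter.atTop, g U < a := by
  obtain ⟨U₀, hU₀⟩ := eventually_le_sInf_add g S hS H (η := (a - sInf S) / 2) (by linarith)
  exact Filter.eventually_atTop.2 ⟨U₀, fun U hU => by linarith [hU₀ U hU]⟩

end Limsup

end GenericLift

end Summit.Ventures.CertifiedQuantumChemistry
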